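import Summits.Ventures.PercRepro.C025ProfileGirthSuccSuccDual

/-!
# THE ROW `(q, q+2)` AT GIRTH `≥ q+1` ON AT MOST `2q + 3` POINTS (night-3 g20)

On `n ≤ 2q + 2` points a `q`-subset `B` has `|E ∖ B| ≤ q + 2`, so its level-`(q+2)` price is nonzero only when
`E ∖ B` is an independent `(q+2)`-set — and then the price is `C(2q+2, q+2)/C(2q+2, q) = 1`.  Hence the thin
inequality (T2′) is the injection `B ↦ E ∖ B` into the clean `(q+2)`-sets (`thinIneq_of_card_le`), and with
`profileIneq_succ_succ_of_thin` the row `(q, q+2)` of (Π) holds unconditionally on every matroid of girth `≥ q + 1`,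
rank `≥ q + 3` and at most `2q + 2` points (`profileIneq_succ_succ_of_card_le`).  On `2q + 3` points the local dual
inequality holds as well: `E ∖ B` has `q + 3` points, and a `(q+3)`-set of rank `q + 2` has at least `q + 1`
independent `(q+2)`-subsets (`card_indep_erase_ge`: a point of the basis whose removal lets the extra point into the
closure lies in at most two such positions, by the intersection property of closures inside an independent set and
the girth), so `price(B) · C(q+1, q) ≤ #{independent (q+2)-subsets of E ∖ B}` (`dual_of_card_le_succ`) and the row
holds on every matroid of girth `≥ q + 1`, rank `≥ q + 3` and at most `2q + 3` points
(`profileIneq_succ_succ_of_card_le_succ`) — the complementation end of the reduction.  No `def`, no `instance`, no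
notation.  Axioms: standard.
-/

open scoped Matroid

namespace PercRepro

open Set Finset ThmH Staged

namespace GirthRows

variable {α : Type} [DecidableEq α] {M : Matroid α} [M.Finite]

open scoped Classical in
/-- On `≤ 2q + 2` points the level-`(q+2)` price of a `q`-set is at most the indicator of «`E ∖ B` is an independent
`(q+2)`-set». -/
theorem price_le_indicator_of_card_le {q : ℕ} (hn : (gr M).card ≤ 2 * q + 2) {B : Finset α} (hBg : B ⊆ gr M)
    (hBc : B.card = q) :
    Profile.price M q (q + 2) B ≤
      (if (gr M \ B).card = q + 2 ∧ M.Indep ((gr M \ B : Finset α) : Set α) then (1 : ℚ) else 0) := by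
  unfold Profile.price
  by_cases hthr : ((q + 2 : ℕ) : ℕ∞) ≤ M.eRk ((gr M \ B : Finset α) : Set α)
  · rw [if_pos hthr]
    -- `ρ(E ∖ B) ≥ q + 2` and `|E ∖ B| ≤ q + 2` force `|E ∖ B| = q + 2` and independence
    have hsd : (gr M \ B).card = (gr M).card - q := by
      rw [Finset.card_sdiff_of_subset hBg, hBc]
    have hrk : q + 2 ≤ rkN M (gr M \ B) := by
      have h := hthr
      rw [← Staged.coe_rkN] at h
      exact_mod_cast h
    have hrc : rkN M (gr M \ B) ≤ (gr M \ B).card := rkN_le_card _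
    have hc : (gr M \ B).card = q + 2 := by omega
    have hind : M.Indep ((gr M \ B : Finset α) : Set α) := by
      by_contra hdep
      have := ThinGirth.rkN_lt_card_of_not_indep (M := M) (X := gr M \ B) hdep
      omega
    rw [if_pos ⟨hc, hind⟩]
    have hr : (M.eRk ((gr M \ B : Finset α) : Set α)).toNat = q + 2 := by
      rw [hind.eRk_eq_encard, Set.encard_coe_eq_coe_finsetCard, hc]
      rfl
    rw [hr, Nat.choose_symm_add (a := q + 2) (b := q)]
    have hpos : (0 : ℚ) < ((q + 2 + q).choose q : ℕ) := by
      exact_mod_cast Nat.choose_pos (by omega : q ≤ q + 2 + q)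
    rw [div_self hpos.ne']
  · rw [if_neg hthr]
    split_ifs
    · exact zero_le_one
    · exact le_rfl

open scoped Classical in
/-- **(T2′) ON AT MOST `2q + 2` POINTS**: `Σ_{B ∈ Rq, #B = q} price(B) ≤ #{clean (q+2)-subsets}` — the priced sets have
`E ∖ B` an independent `(q+2)`-set, which is clean, and `B ↦ E ∖ B` is injective. -/
theorem thinIneq_of_card_le {q : ℕ} (hn : (gr M).card ≤ 2 * q + 2) :
    ∑ B ∈ (Profile.Rq M q).filter (fun B : Finset α => B.card = q), Profile.price M q (q + 2) B ≤
      ((((gr M).powersetCard (q + 2)).filter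
        (fun U : Finset α => ∀ X ⊆ U, X.card = q + 1 → M.Indep (X : Set α))).card : ℚ) := by
  set T := (Profile.Rq M q).filter (fun B : Finset α => B.card = q) with hT
  set CL := ((gr M).powersetCard (q + 2)).filter
    (fun U : Finset α => ∀ X ⊆ U, X.card = q + 1 → M.Indep (X : Set α)) with hCL
  have hTmem : ∀ B ∈ T, B ⊆ gr M ∧ B.card = q := by
    intro B hB
    rw [hT, Finset.mem_filter, Profile.mem_Rq] at hB
    exact ⟨hB.1.1, hB.2⟩
  calc ∑ B ∈ T, Profile.price M q (q + 2) B
      ≤ ∑ B ∈ T, (if (gr M \ B).card = q + 2 ∧ M.Indep ((gr M \ B : Finset α) : Set α) then (1 : ℚ) else 0) :=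
        Finset.sum_le_sum (fun B hB => price_le_indicator_of_card_le hn (hTmem B hB).1 (hTmem B hB).2)
    _ = ((T.filter (fun B => (gr M \ B).card = q + 2 ∧ M.Indep ((gr M \ B : Finset α) : Set α))).card : ℚ) := by
        rw [Finset.sum_boole]
    _ ≤ (CL.card : ℚ) := by
        apply Nat.cast_le.2
        apply Finset.card_le_card_of_injOn (fun B => gr M \ B)
        · intro B hB
          rw [Finset.mem_coe, Finset.mem_filter] at hB
          rw [Finset.mem_coe, hCL, Finset.mem_filter, Finset.mem_powersetCard]
          exact ⟨⟨Finset.sdiff_subset, hB.2.1⟩, clean_of_indep hB.2.2⟩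
        · intro B hB B' hB' heq
          rw [Finset.mem_coe, Finset.mem_filter] at hB hB'
          have h1 := (hTmem B hB.1).1
          have h2 := (hTmem B' hB'.1).1
          simp only at heq
          have : gr M \ (gr M \ B) = gr M \ (gr M \ B') := by rw [heq]
          rwa [Finset.sdiff_sdiff_eq_self h1, Finset.sdiff_sdiff_eq_self h2] at this

/-- **THE ROW `(q, q+2)` OF (Π) AT GIRTH `≥ q + 1` ON AT MOST `2q + 2` POINTS** (rank `≥ q + 3`, `q ≥ 1`):
unconditional — the complementation end of the reduction `profileIneq_succ_succ_of_thin`. -/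
theorem profileIneq_succ_succ_of_card_le {q : ℕ} (hq : 1 ≤ q) (hg : ∀ T ⊆ M.E, T.encard ≤ q → M.Indep T)
    (hrank : ((q + 3 : ℕ) : ℕ∞) ≤ M.eRank) (hn : (gr M).card ≤ 2 * q + 2) :
    Profile.ProfileIneq M q (q + 2) :=
  profileIneq_succ_succ_of_thin hq hg hrank (thinIneq_of_card_le hn)

open scoped Classical in
/-- **A `(q+3)`-set of rank `q + 2` has at least `q + 1` independent `(q+2)`-subsets** (girth `≥ q + 1`): with a basis
`I = A ∖ a₀`, the subsets `A ∖ a` (`a ∈ I`) fail to be independent exactly when `a₀ ∈ cl(I ∖ a)`; three such `a` would put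
`a₀` in the closure of a `(q−1)`-subset of `I`, making a `q`-set dependent. -/
theorem card_indep_erase_ge {q : ℕ} (hg : ∀ T ⊆ M.E, T.encard ≤ q → M.Indep T) {A : Finset α}
    (hAg : A ⊆ gr M) (hAc : A.card = q + 3) (hAr : rkN M A = q + 2) :
    q + 1 ≤ (A.filter (fun a => M.Indep ((A.erase a : Finset α) : Set α))).card := by
  have hAE : (A : Set α) ⊆ M.E := by
    rw [← coe_gr]
    exact_mod_cast hAg
  -- a basis of `A`, as a finset `I ⊆ A` with `q + 2` elements
  obtain ⟨I₀, hI₀⟩ := M.exists_isBasis (A : Set α) hAE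
  have hfin : I₀.Finite := M.ground_finite.subset hI₀.indep.subset_ground
  set I := hfin.toFinset with hI
  have hIA : I ⊆ A := by
    intro z hz
    rw [hI, Set.Finite.mem_toFinset] at hz
    exact Finset.mem_coe.1 (hI₀.subset hz)
  have hIi : M.Indep (I : Set α) := by
    rw [hI, Set.Finite.coe_toFinset]
    exact hI₀.indep
  have hIc : I.card = q + 2 := by
    have h1 := hI₀.encard_eq_eRk
    rw [← Set.Finite.coe_toFinset hfin, Set.encard_coe_eq_coe_finsetCard, ← Staged.coe_rkN, hAr] at h1
    exact_mod_cast h1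
  -- the extra point `a₀`
  have hdiff : (A \ I).card = 1 := by
    rw [Finset.card_sdiff_of_subset hIA, hAc, hIc]
    omega
  obtain ⟨a₀, ha₀⟩ := Finset.card_eq_one.1 hdiff
  have ha₀A : a₀ ∈ A := (Finset.mem_sdiff.1 (ha₀ ▸ Finset.mem_singleton_self a₀)).1
  have ha₀I : a₀ ∉ I := (Finset.mem_sdiff.1 (ha₀ ▸ Finset.mem_singleton_self a₀)).2
  have hAeq : A = insert a₀ I := by
    ext z
    constructor
    · intro hz
      by_cases hzI : z ∈ I
      · exact Finset.mem_insert_of_mem hzI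
      · have : z ∈ A \ I := Finset.mem_sdiff.2 ⟨hz, hzI⟩
        rw [ha₀, Finset.mem_singleton] at this
        rw [this]
        exact Finset.mem_insert_self _ _
    · intro hz
      rw [Finset.mem_insert] at hz
      rcases hz with rfl | hz
      · exact ha₀A
      · exact hIA hz
  -- `A ∖ a₀ = I` is independent
  have hIerase : A.erase a₀ = I := by
    rw [hAeq, Finset.erase_insert ha₀I]
  -- for `a ∈ I`: `A ∖ a = insert a₀ (I ∖ a)`
  have herase : ∀ a ∈ I, A.erase a = insert a₀ (I.erase a) := by
    intro a ha
    have hne : a ≠ a₀ := fun h => ha₀I (h ▸ ha)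
    rw [hAeq, Finset.erase_insert_of_ne hne.symm]
  -- the bad positions: `a ∈ I` with `a₀ ∈ cl(I ∖ a)`
  set D := I.filter (fun a => a₀ ∈ M.closure ((I.erase a : Finset α) : Set α)) with hD
  have hDle : D.card ≤ 2 := by
    by_contra hcon
    push Not at hcon
    obtain ⟨a, ha, b, hb, c, hc, hab, hac, hbc⟩ := Finset.two_lt_card.1 hcon
    rw [hD, Finset.mem_filter] at ha hb hc
    -- `a₀ ∈ cl(I ∖ a) ∩ cl(I ∖ b) ∩ cl(I ∖ c) = cl(I ∖ {a, b, c})`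
    have h1 : M.closure (((I.erase a : Finset α) : Set α) ∩ ((I.erase b : Finset α) : Set α)) =
        M.closure ((I.erase a : Finset α) : Set α) ∩ M.closure ((I.erase b : Finset α) : Set α) := by
      apply Matroid.Indep.closure_inter_eq_inter_closure
      apply hIi.subset
      rw [← Finset.coe_union]
      exact Finset.coe_subset.2 (Finset.union_subset (Finset.erase_subset _ _) (Finset.erase_subset _ _))
    have h2 : M.closure ((((I.erase a : Finset α) : Set α) ∩ ((I.erase b : Finset α) : Set α)) ∩
        ((I.erase c : Finset α) : Set α)) =
        M.closure (((I.erase a : Finset α) : Set α) ∩ ((I.erase b : Finset α) : Set α)) ∩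
          M.closure ((I.erase c : Finset α) : Set α) := by
      apply Matroid.Indep.closure_inter_eq_inter_closure
      apply hIi.subset
      intro z hz
      rcases hz with hz | hz
      · exact Finset.mem_coe.2 (Finset.mem_of_mem_erase (Finset.mem_coe.1 hz.1))
      · exact Finset.mem_coe.2 (Finset.mem_of_mem_erase (Finset.mem_coe.1 hz))
    have hmem : a₀ ∈ M.closure ((((I.erase a : Finset α) : Set α) ∩ ((I.erase b : Finset α) : Set α)) ∩
        ((I.erase c : Finset α) : Set α)) := by
      rw [h2, h1]
      exact ⟨⟨ha.2, hb.2⟩, hc.2⟩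
    -- the triple intersection is the finset `((I.erase a).erase b).erase c`, of `q − 1` points
    set K := ((I.erase a).erase b).erase c with hK
    have hKcoe : (((I.erase a : Finset α) : Set α) ∩ ((I.erase b : Finset α) : Set α)) ∩
        ((I.erase c : Finset α) : Set α) = (K : Set α) := by
      ext z
      simp only [Set.mem_inter_iff, Finset.mem_coe, Finset.mem_erase, hK]
      tauto
    rw [hKcoe] at hmem
    have hKI : K ⊆ I := (Finset.erase_subset _ _).trans ((Finset.erase_subset _ _).trans (Finset.erase_subset _ _))
    have hKi : M.Indep (K : Set α) := hIi.subset (Finset.coe_subset.2 hKI)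
    have ha₀K : a₀ ∉ K := fun h => ha₀I (hKI h)
    have hKc : K.card = q - 1 := by
      rw [hK, Finset.card_erase_of_mem, Finset.card_erase_of_mem, Finset.card_erase_of_mem ha.1, hIc]
      · omega
      · rw [Finset.mem_erase]
        exact ⟨hab.symm, hb.1⟩
      · rw [Finset.mem_erase, Finset.mem_erase]
        exact ⟨hbc.symm, hac.symm, hc.1⟩
    -- `insert a₀ K` is dependent (`a₀ ∈ cl K`) yet has `q` points
    have hdep : ¬ M.Indep ((insert a₀ K : Finset α) : Set α) := by
      rw [Finset.coe_insert, hKi.insert_indep_iff_of_notMem ha₀K]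
      intro h
      exact h.2 hmem
    apply hdep
    apply hg
    · rw [← coe_gr]
      exact_mod_cast Finset.insert_subset (hAg ha₀A) (hKI.trans (hIA.trans hAg))
    · rw [Set.encard_coe_eq_coe_finsetCard, Finset.card_insert_of_notMem ha₀K, hKc]
      have hq1 : 1 ≤ q := by
        by_contra h0
        push Not at h0
        -- with `q = 0`, `I` has two points and cannot contain three distinct ones
        have : I.card ≥ 3 := by
          have := Finset.two_lt_card.2 ⟨a, ha.1, b, hb.1, c, hc.1, hab, hac, hbc⟩
          omega
        omega
      exact_mod_cast (by omega : q - 1 + 1 ≤ q)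
  -- the good positions contain `(I ∖ D) ∪ {a₀}`
  have hgood : insert a₀ (I \ D) ⊆ A.filter (fun a => M.Indep ((A.erase a : Finset α) : Set α)) := by
    intro z hz
    rw [Finset.mem_insert] at hz
    rw [Finset.mem_filter]
    rcases hz with rfl | hz
    · refine ⟨ha₀A, ?_⟩
      rw [hIerase]
      exact hIi
    · rw [Finset.mem_sdiff, hD, Finset.mem_filter] at hz
      refine ⟨hIA hz.1, ?_⟩
      rw [herase z hz.1, Finset.coe_insert]
      have hzi : M.Indep ((I.erase z : Finset α) : Set α) := hIi.subset (Finset.coe_subset.2 (Finset.erase_subset _ _))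
      have ha₀z : a₀ ∉ I.erase z := fun h => ha₀I (Finset.mem_of_mem_erase h)
      rw [hzi.insert_indep_iff_of_notMem ha₀z]
      refine ⟨by rw [← coe_gr]; exact_mod_cast hAg ha₀A, ?_⟩
      intro hcl
      exact hz.2 ⟨hz.1, hcl⟩
  have hcard := Finset.card_le_card hgood
  rw [Finset.card_insert_of_notMem (fun h => ha₀I (Finset.mem_sdiff.1 h).1),
    Finset.card_sdiff_of_subset (Finset.filter_subset _ _), hIc] at hcard
  have hDle' : (I.filter (fun a => a₀ ∈ M.closure ((I.erase a : Finset α) : Set α))).card ≤ 2 := by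
    rw [← hD]
    exact hDle
  omega

open scoped Classical in
/-- **The local dual inequality on at most `2q + 3` points**: `price(B) · C(n − q − 2, q) ≤ #{independent (q+2)-subsets
of E ∖ B}` for every `q`-subset `B` (girth `≥ q + 1`). -/
theorem dual_of_card_le_succ {q : ℕ} (hg : ∀ T ⊆ M.E, T.encard ≤ q → M.Indep T)
    (hn : (gr M).card ≤ 2 * q + 3) :
    ∀ B ∈ (gr M).powersetCard q,
      Profile.price M q (q + 2) B * (((gr M).card - q - 2).choose q : ℚ) ≤
        ((((gr M \ B).powersetCard (q + 2)).filter (fun U : Finset α => M.Indep (U : Set α))).card : ℚ) := by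
  intro B hB
  rw [Finset.mem_powersetCard] at hB
  obtain ⟨hBg, hBc⟩ := hB
  have hsd : (gr M \ B).card = (gr M).card - q := by
    rw [Finset.card_sdiff_of_subset hBg, hBc]
  set A := gr M \ B with hA
  have hAg : A ⊆ gr M := Finset.sdiff_subset
  -- the price: zero unless `ρ(A) ≥ q + 2`
  unfold Profile.price
  split_ifs with hthr
  · have hrk : q + 2 ≤ rkN M A := by
      have h := hthr
      rw [← Staged.coe_rkN] at h
      exact_mod_cast h
    have hrc : rkN M A ≤ A.card := rkN_le_card _
    have hpdef : (M.eRk (A : Set α)).toNat = rkN M A := rfl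
    rw [hpdef]
    -- `|A| ∈ {q + 2, q + 3}`
    rcases (show A.card = q + 2 ∨ A.card = q + 3 by omega) with hc | hc
    · -- `n = 2q + 2`: `A` is an independent `(q+2)`-set, price `1`, `C(q, q) = 1`
      have hind : M.Indep (A : Set α) := by
        by_contra hdep
        have := ThinGirth.rkN_lt_card_of_not_indep (M := M) (X := A) hdep
        omega
      have hr : rkN M A = q + 2 := by omega
      have hCn : (gr M).card - q - 2 = q := by omega
      rw [hr, hCn, Nat.choose_self, Nat.choose_symm_add (a := q + 2) (b := q), div_self, Nat.cast_one, one_mul]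
      · have hmem : A ∈ (A.powersetCard (q + 2)).filter (fun U : Finset α => M.Indep (U : Set α)) := by
          rw [Finset.mem_filter, Finset.mem_powersetCard]
          exact ⟨⟨Finset.Subset.refl _, hc⟩, hind⟩
        have := Finset.card_pos.2 ⟨A, hmem⟩
        exact_mod_cast this
      · exact_mod_cast (Nat.choose_pos (by omega : q ≤ q + 2 + q)).ne'
    · -- `n = 2q + 3`: `C(q+1, q) = q + 1`
      have hCn : (gr M).card - q - 2 = q + 1 := by omega
      rw [hCn, Nat.choose_succ_self_right]
      -- the `(q+2)`-subsets of `A` are the `A ∖ a`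
      have hsubs : (A.powersetCard (q + 2)).filter (fun U : Finset α => M.Indep (U : Set α)) =
          (A.filter (fun a => M.Indep ((A.erase a : Finset α) : Set α))).image (fun a => A.erase a) := by
        ext U
        simp only [Finset.mem_filter, Finset.mem_powersetCard, Finset.mem_image]
        constructor
        · rintro ⟨⟨hUA, hUc⟩, hUi⟩
          have h1 : (A \ U).card = 1 := by
            rw [Finset.card_sdiff_of_subset hUA, hc, hUc]
            omega
          obtain ⟨a, ha⟩ := Finset.card_eq_one.1 h1
          have haA : a ∈ A := (Finset.mem_sdiff.1 (ha ▸ Finset.mem_singleton_self a)).1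
          have hUeq : U = A.erase a := by
            ext z
            rw [Finset.mem_erase]
            constructor
            · intro hz
              refine ⟨?_, hUA hz⟩
              intro hza
              have : z ∈ A \ U := ha ▸ Finset.mem_singleton.2 hza
              exact (Finset.mem_sdiff.1 this).2 hz
            · rintro ⟨hza, hzA⟩
              by_contra hzU
              have : z ∈ A \ U := Finset.mem_sdiff.2 ⟨hzA, hzU⟩
              rw [ha, Finset.mem_singleton] at this
              exact hza this
          refine ⟨a, ⟨haA, ?_⟩, hUeq.symm⟩
          rw [← hUeq]
          exact hUi
        · rintro ⟨a, ⟨haA, hai⟩, rfl⟩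
          refine ⟨⟨Finset.erase_subset _ _, ?_⟩, hai⟩
          rw [Finset.card_erase_of_mem haA, hc]
          rfl
      have hinj : Set.InjOn (fun a => A.erase a) ((A.filter (fun a => M.Indep ((A.erase a : Finset α) : Set α))) : Set α) := by
        intro a ha a' ha' heq
        rw [Finset.mem_coe, Finset.mem_filter] at ha ha'
        simp only at heq
        by_contra hne
        have : a ∈ A.erase a' := Finset.mem_erase.2 ⟨hne, ha.1⟩
        rw [← heq, Finset.mem_erase] at this
        exact this.1 rfl
      rw [hsubs, Finset.card_image_of_injOn hinj]
      rcases (show rkN M A = q + 2 ∨ rkN M A = q + 3 by omega) with hr | hr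
      · -- price `1`; at least `q + 1` independent subsets
        rw [hr, Nat.choose_symm_add (a := q + 2) (b := q), div_self, one_mul]
        · exact_mod_cast card_indep_erase_ge hg hAg hc hr
        · exact_mod_cast (Nat.choose_pos (by omega : q ≤ q + 2 + q)).ne'
      · -- `A` independent: all `q + 3` subsets independent; price `(q+3)/(q+1)`
        have hind : M.Indep (A : Set α) := by
          by_contra hdep
          have := ThinGirth.rkN_lt_card_of_not_indep (M := M) (X := A) hdep
          omega
        have hall : A.filter (fun a => M.Indep ((A.erase a : Finset α) : Set α)) = A := by
          apply Finset.filter_true_of_mem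
          intro a _
          exact hind.subset (Finset.coe_subset.2 (Finset.erase_subset _ _))
        rw [hall, hc, hr]
        -- `C(2q+3, q+2)/C(2q+3, q) · (q+1) = q + 3`
        have hid := choose_succ_succ_mul_choose_two (q + 3) q
        have hpos : (0 : ℚ) < ((q + 3 + q).choose q : ℕ) := by
          exact_mod_cast Nat.choose_pos (by omega : q ≤ q + 3 + q)
        rw [div_mul_eq_mul_div, div_le_iff₀ hpos]
        have h1 : ((q + 3 + q).choose (q + 2) : ℚ) * ((q + 2).choose 2 : ℕ) =
            ((q + 3 + q).choose q : ℕ) * ((q + 3).choose 2 : ℕ) := by exact_mod_cast hid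
        have h2 : ((q + 2).choose 2 : ℚ) = (q + 2) * (q + 1) / 2 := by
          rw [Nat.cast_choose_two]; push_cast; ring
        have h3 : ((q + 3).choose 2 : ℚ) = (q + 3) * (q + 2) / 2 := by
          rw [Nat.cast_choose_two]; push_cast; ring
        rw [h2, h3] at h1
        have hq2 : (0 : ℚ) < (q + 2) * (q + 1) / 2 := by positivity
        have h4 : ((q + 3 + q).choose (q + 2) : ℚ) = ((q + 3 + q).choose q : ℕ) * (q + 3) / (q + 1) := by
          field_simp
          nlinarith [h1]
        rw [h4]
        push_cast
        rw [div_mul_eq_mul_div]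
        have hq1 : (0 : ℚ) < (q : ℚ) + 1 := by positivity
        rw [div_le_iff₀ hq1]
        ring_nf
        exact le_rfl
  · rw [zero_mul]
    exact Nat.cast_nonneg _

/-- **THE ROW `(q, q+2)` OF (Π) AT GIRTH `≥ q + 1` ON AT MOST `2q + 3` POINTS** (rank `≥ q + 3`, `q ≥ 1`): unconditional. -/
theorem profileIneq_succ_succ_of_card_le_succ {q : ℕ} (hq : 1 ≤ q) (hg : ∀ T ⊆ M.E, T.encard ≤ q → M.Indep T)
    (hrank : ((q + 3 : ℕ) : ℕ∞) ≤ M.eRank) (hn : (gr M).card ≤ 2 * q + 3) :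
    Profile.ProfileIneq M q (q + 2) :=
  profileIneq_succ_succ_of_dual hq hg hrank (dual_of_card_le_succ hg hn)

end GirthRows

end PercRepro
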